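import Summits.QuantumFields.YangMills.Theorems.AllWindowsColdBoxBoxHighLinePlaqSourcePair
import Summits.QuantumFields.YangMills.Theorems.AllWindowsColdBoxBoxHighLineHodgeSupports
import Summits.QuantumFields.YangMills.Theorems.AllWindowsColdBoxBoxHighLineHodgeBootstrap

/-!
# LINE-20 U1b/U1c — the per-source inputs `a₀, a₁, a₂, a₃` of the Schur–Jaffard gradient/dipole theorems for `λ_p = landauCoeff H p`

Bookkeeping between the plaquette-source estimates (✓`PlaqSource.restInv_mulVec_landauCoeff_decay` = raw `a₁`,
✓`PlaqSource.landauCoeff_restInv_landauCoeff_decay` = raw `a₃`) and the hypotheses of ✓`schur_jaffard_gradient_decay` /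
✓`schur_jaffard_dipole_decay'` in w2's skin/rest block form (✓`…SchurBlocks`: `skinRest`, `coupling`, `restInv`, `sumDist`):
* `hodgeQ_inv_mulVec_eq`, `dotProduct_hodgeQ_inv_mulVec_eq` — `hodgeQ⁻¹ *ᵥ v` and `u ⬝ᵥ hodgeQ⁻¹ *ᵥ v` through the block inverse;
* `abs_sub_le_one_of_landauCoeff_ne_zero` — an edge carrying `λ_p` has its base point within sup-distance `1` of `p.1`;
* `coupling_mulVec_eq_sum` — **`(coupling *ᵥ u)(s) = Σ_{q ∈ hodgePlaqs} (λ_q|rest ⬝ᵥ u)·λ_q(s)`** (a skin row has no gauge term);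
* `source_a0`, `source_a1`, `source_a2`, `source_a3` — the four inputs, anchored at any free edge `e₁` carrying `λ_p` (constants uniform in `H`).
No definitions; standard axioms.

HONEST LABEL: helper toward the OPEN stub U1 `stub_landauKernelPackage` (⟨stmt-QuantumFields-24336⟩) of a critic-stamped DRAFT line on the R2ξ″ crux;
no stub, crux, rung or summit is proved here; the Yang–Mills mass gap is NOT proved by this file.
-/

set_option autoImplicit false

noncomputable section

namespace Summit.QuantumFields.YangMills.Theorems.AllWindowsColdBoxBoxHighLine

open Finset Matrix
open Literature.Probability.LatticeModels (Site)
open Literature.MathematicalPhysics.QuantumFieldTheory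
open Literature.MathematicalPhysics.QuantumFieldTheory.LatticeMaxwell
open Literature.MathematicalPhysics.QuantumFieldTheory.AxialGauge
open Summit.QuantumFields.YangMills.Theorems.WeakCouplingRates
open Summit.QuantumFields.YangMills.Theorems.AllWindowsColdBox.BoxKernel
open RestBlock

namespace PlaqSource

variable {H : ℕ}

/-! ## `hodgeQ⁻¹` through the block inverse -/

/-- `hodgeQ⁻¹ *ᵥ v` read through the skin/rest block inverse. -/
theorem hodgeQ_inv_mulVec_eq (v : LandauFree H → ℝ) (e : LandauFree H) :
    ((hodgeQ H)⁻¹ *ᵥ v) e =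
      (@Inv.inv _ (@Matrix.inv _ _ _ instDecidableEqSum _)
          (Matrix.fromBlocks (skinBlock H) (coupling H) (coupling H)ᵀ (restBlock H)) *ᵥ
        Sum.elim (fun s : Skin H => v s.1) (fun r : Rest H => v r.1)) ((skinRest H).symm e) := by
  letI : DecidableEq (Skin H ⊕ Rest H) := instDecidableEqSum
  simp only [Matrix.mulVec, dotProduct]
  rw [← Equiv.sum_comp (skinRest H) (fun e' => (hodgeQ H)⁻¹ e e' * v e')]
  refine Finset.sum_congr rfl fun b _ => ?_
  rw [hodgeQ_inv_apply, Equiv.symm_apply_apply]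
  rcases b with s | r <;> rfl

/-- `u ⬝ᵥ hodgeQ⁻¹ *ᵥ v` read through the skin/rest block inverse. -/
theorem dotProduct_hodgeQ_inv_mulVec_eq (u v : LandauFree H → ℝ) :
    u ⬝ᵥ ((hodgeQ H)⁻¹ *ᵥ v) =
      Sum.elim (fun s : Skin H => u s.1) (fun r : Rest H => u r.1) ⬝ᵥ
        ((@Inv.inv _ (@Matrix.inv _ _ _ instDecidableEqSum _)
            (Matrix.fromBlocks (skinBlock H) (coupling H) (coupling H)ᵀ (restBlock H)) *ᵥ
          Sum.elim (fun s : Skin H => v s.1) (fun r : Rest H => v r.1))) := by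
  letI : DecidableEq (Skin H ⊕ Rest H) := instDecidableEqSum
  rw [dotProduct, dotProduct, ← Equiv.sum_comp (skinRest H) (fun e => u e * ((hodgeQ H)⁻¹ *ᵥ v) e)]
  refine Finset.sum_congr rfl fun b _ => ?_
  rw [hodgeQ_inv_mulVec_eq v (skinRest H b), Equiv.symm_apply_apply]
  rcases b with s | r <;> rfl

/-! ## The support of `λ_p` -/

/-- An edge carrying `λ_p` has its base point within sup-distance `1` of `p.1` (it is one of the four edges of `p`). -/
theorem abs_sub_le_one_of_landauCoeff_ne_zero {p : Plaq 4} {e : LandauFree H} (h : landauCoeff H p e ≠ 0) (κ : Fin 4) :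
    |((e.1.1.1 κ : ℤ) : ℝ) - ((p.1 κ : ℤ) : ℝ)| ≤ 1 := by
  have h1 := l1_le_one_of_landauCoeff_ne_zero h
  have h2 : |e.1.1.1 κ - p.1 κ| ≤ ∑ m : Fin 4, |e.1.1.1 m - p.1 m| :=
    Finset.single_le_sum (f := fun m => |e.1.1.1 m - p.1 m|) (fun m _ => abs_nonneg _) (Finset.mem_univ κ)
  have h3 : |e.1.1.1 κ - p.1 κ| ≤ 1 := h2.trans h1
  rw [← Int.cast_sub, ← Int.cast_abs]
  exact_mod_cast h3

/-- If no free edge carries `λ_p`, the source vanishes on the box. -/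
theorem landauCoeff_eq_zero_of_forall {p : Plaq 4} (h : ¬ ∃ e : LandauFree H, landauCoeff H p e ≠ 0) : landauCoeff H p = 0 := by
  funext e
  by_contra hne
  exact h ⟨e, hne⟩

/-- `linkDist` is attained at a coordinate: a pointwise bound at that coordinate bounds the weight. -/
theorem one_add_linkDist_le_of {e e' : LandauFree H} {y : Site 4} {t : ℝ}
    (hy : ∀ κ, |((e'.1.1.1 κ : ℤ) : ℝ) - ((y κ : ℤ) : ℝ)| ≤ t) :
    ∃ κ : Fin 4, 1 + linkDist e e' ≤ 1 + (|((e.1.1.1 κ : ℤ) : ℝ) - ((y κ : ℤ) : ℝ)| + t) := by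
  obtain ⟨κ, hκ⟩ := exists_linkDist_eq e e'
  refine ⟨κ, ?_⟩
  rw [hκ, Int.cast_sub]
  have := abs_sub_le (((e.1.1.1 κ : ℤ) : ℝ)) (((y κ : ℤ) : ℝ)) (((e'.1.1.1 κ : ℤ) : ℝ))
  rw [abs_sub_comm (((y κ : ℤ) : ℝ))] at this
  linarith [hy κ]

/-! ## The skin rows against a rest vector: `(coupling *ᵥ u)(s) = Σ_q (λ_q|rest ⬝ᵥ u)·λ_q(s)` -/

/-- The zero extension of a rest vector to all free edges. -/
theorem coupling_mulVec_eq_sum (u : Rest H → ℝ) (s : Skin H) :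
    (coupling H *ᵥ u) s = ∑ q ∈ hodgePlaqs H, ((fun r : Rest H => landauCoeff H q r.1) ⬝ᵥ u) * landauCoeff H q s.1 := by
  classical
  -- the zero extension `ũ` of `u`
  set ut : LandauFree H → ℝ := fun e =>
    if h : (e.1.1.1 ∈ interiorSites H ∨ e.1.1.1 + Pi.single e.1.1.2 1 ∈ interiorSites H) then u ⟨e, h⟩ else 0 with hut
  have hrest : ∀ r : Rest H, ut r.1 = u r := fun r => by simp only [hut]; rw [dif_pos r.2]
  have hskin : ∀ s' : Skin H, ut s'.1 = 0 := fun s' => by simp only [hut]; rw [dif_neg s'.2]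
  -- any pairing with `ũ` is the rest pairing
  have hpair : ∀ w : LandauFree H → ℝ, w ⬝ᵥ ut = (fun r : Rest H => w r.1) ⬝ᵥ u := by
    intro w
    rw [dotProduct, dotProduct, ← Equiv.sum_comp (skinRest H) (fun e => w e * ut e), Fintype.sum_sum_type]
    simp only [skinRest_inl, skinRest_inr, hskin, mul_zero, Finset.sum_const_zero, zero_add, hrest]
  -- `(coupling *ᵥ u) s = (hodgeQ *ᵥ ũ) s`
  have hrow : (coupling H *ᵥ u) s = (hodgeQ H *ᵥ ut) s.1 := by
    rw [Matrix.mulVec, Matrix.mulVec, dotProduct, dotProduct, ← Equiv.sum_comp (skinRest H) (fun e => hodgeQ H s.1 e * ut e),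
      Fintype.sum_sum_type]
    simp only [skinRest_inl, skinRest_inr, hskin, mul_zero, Finset.sum_const_zero, zero_add, hrest, coupling, Matrix.of_apply]
  rw [hrow, hodgeQ_mulVec ut]
  -- the gauge terms vanish at a skin link
  have hgrad : ∀ x ∈ interiorSites H, gradVec H x s.1 = 0 := by
    intro x hx
    unfold gradVec
    rw [if_neg, if_neg, sub_zero]
    · intro h; exact s.2 (Or.inl (h ▸ hx))
    · intro h; exact s.2 (Or.inr (h ▸ hx))
  rw [Pi.add_apply, Finset.sum_apply, Finset.sum_apply]
  have h0 : ∑ x ∈ interiorSites H, ((gradVec H x ⬝ᵥ ut) • gradVec H x) s.1 = 0 :=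
    Finset.sum_eq_zero fun x hx => by rw [Pi.smul_apply, hgrad x hx, smul_zero]
  rw [h0, add_zero]
  exact Finset.sum_congr rfl fun q _ => by rw [Pi.smul_apply, smul_eq_mul, hpair]

/-! ## The four inputs, anchored at a free edge `e₁` carrying `λ_p` -/

/-- **`a₀`**: the skin part of the source is supported within sup-distance `2` of the anchor: `|λ_p(s)|·(1 + d(s, e₁))⁴ ≤ 162`. -/
theorem source_a0 {p : Plaq 4} {e₁ : LandauFree H} (he₁ : landauCoeff H p e₁ ≠ 0) (s : Skin H) :
    |landauCoeff H p s.1| * (1 + sumDist H (Sum.inl s) ((skinRest H).symm e₁)) ^ (4 : ℝ) ≤ 162 := by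
  have hd : sumDist H (Sum.inl s) ((skinRest H).symm e₁) = linkDist s.1 e₁ := by simp [sumDist]
  rw [hd, show ((4 : ℝ)) = ((4 : ℕ) : ℝ) by norm_num, Real.rpow_natCast]
  by_cases hs : landauCoeff H p s.1 = 0
  · rw [hs, abs_zero, zero_mul]; norm_num
  · obtain ⟨κ, hκ⟩ := one_add_linkDist_le_of (e := s.1) (abs_sub_le_one_of_landauCoeff_ne_zero he₁)
    have h1 := abs_sub_le_one_of_landauCoeff_ne_zero hs κ
    have hL : 1 + linkDist s.1 e₁ ≤ 3 := by linarith
    have hL0 : 0 ≤ 1 + linkDist s.1 e₁ := by linarith [linkDist_nonneg s.1 e₁]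
    have hpow : (1 + linkDist s.1 e₁) ^ 4 ≤ 81 := by
      calc (1 + linkDist s.1 e₁) ^ 4 ≤ (3 : ℝ) ^ 4 := pow_le_pow_left₀ hL0 hL 4
        _ = 81 := by norm_num
    calc |landauCoeff H p s.1| * (1 + linkDist s.1 e₁) ^ 4 ≤ 2 * 81 :=
          mul_le_mul (abs_landauCoeff_le_two p s.1) hpow (by positivity) (by norm_num)
      _ = 162 := by norm_num

/-- **`a₁`**: the rest response of the source decays like `(1 + d(r, e₁))⁻³` (✓`restInv_mulVec_landauCoeff_decay`, re-anchored). -/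
theorem source_a1 : ∃ a₁ : ℝ, 0 ≤ a₁ ∧ ∀ (H : ℕ), 1 ≤ H → ∀ {p : Plaq 4} {e₁ : LandauFree H}, landauCoeff H p e₁ ≠ 0 →
    ∀ r : Rest H, |(restInv H *ᵥ fun r' : Rest H => landauCoeff H p r'.1) r| *
      (1 + sumDist H (Sum.inr r) ((skinRest H).symm e₁)) ^ (3 : ℝ) ≤ a₁ := by
  obtain ⟨C, hC0, hC⟩ := restInv_mulVec_landauCoeff_decay
  refine ⟨8 * C, by positivity, ?_⟩
  intro H hH p e₁ he₁ r
  haveI : NeZero H := ⟨by omega⟩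
  have hd : sumDist H (Sum.inr r) ((skinRest H).symm e₁) = linkDist r.1 e₁ := by simp [sumDist]
  rw [hd, show ((3 : ℝ)) = ((3 : ℕ) : ℝ) by norm_num, Real.rpow_natCast]
  obtain ⟨κ, hκ⟩ := one_add_linkDist_le_of (e := r.1) (abs_sub_le_one_of_landauCoeff_ne_zero he₁)
  have h := hC H p r κ
  have hX := abs_nonneg ((restInv H *ᵥ fun r' : Rest H => landauCoeff H p r'.1) r)
  have hL0 : 0 ≤ 1 + linkDist r.1 e₁ := by linarith [linkDist_nonneg r.1 e₁]
  have hpow : (1 + linkDist r.1 e₁) ^ 3 ≤ 8 * (1 + |((r.1.1.1.1 κ : ℤ) : ℝ) - ((p.1 κ : ℤ) : ℝ)|) ^ 3 := by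
    have hA : 0 ≤ |((r.1.1.1.1 κ : ℤ) : ℝ) - ((p.1 κ : ℤ) : ℝ)| := abs_nonneg _
    calc (1 + linkDist r.1 e₁) ^ 3 ≤ (2 * (1 + |((r.1.1.1.1 κ : ℤ) : ℝ) - ((p.1 κ : ℤ) : ℝ)|)) ^ 3 :=
          pow_le_pow_left₀ hL0 (by linarith) 3
      _ = 8 * (1 + |((r.1.1.1.1 κ : ℤ) : ℝ) - ((p.1 κ : ℤ) : ℝ)|) ^ 3 := by ring
  calc |(restInv H *ᵥ fun r' : Rest H => landauCoeff H p r'.1) r| * (1 + linkDist r.1 e₁) ^ 3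
        ≤ |(restInv H *ᵥ fun r' : Rest H => landauCoeff H p r'.1) r| * (8 * (1 + |((r.1.1.1.1 κ : ℤ) : ℝ) - ((p.1 κ : ℤ) : ℝ)|) ^ 3) :=
        mul_le_mul_of_nonneg_left hpow hX
    _ = 8 * (|(restInv H *ᵥ fun r' : Rest H => landauCoeff H p r'.1) r| * (1 + |((r.1.1.1.1 κ : ℤ) : ℝ) - ((p.1 κ : ℤ) : ℝ)|) ^ 3) := by
        ring
    _ ≤ 8 * C := mul_le_mul_of_nonneg_left h (by norm_num)

/-- **`a₃`** (re-anchored): `|λ_p|rest ⬝ᵥ restInv *ᵥ λ_q|rest|·(1 + d(e₁, e₁'))⁴ ≤ a₃` for anchors `e₁` of `p` and `e₁'` of `q`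
(✓`landauCoeff_restInv_landauCoeff_decay`). -/
theorem source_a3 : ∃ a₃ : ℝ, 0 ≤ a₃ ∧ ∀ (H : ℕ), 1 ≤ H → ∀ {p q : Plaq 4} {e₁ e₁' : LandauFree H},
    landauCoeff H p e₁ ≠ 0 → landauCoeff H q e₁' ≠ 0 →
    |(fun r : Rest H => landauCoeff H p r.1) ⬝ᵥ (restInv H *ᵥ fun r : Rest H => landauCoeff H q r.1)| *
      (1 + sumDist H ((skinRest H).symm e₁) ((skinRest H).symm e₁')) ^ (4 : ℝ) ≤ a₃ := by
  obtain ⟨C, hC0, hC⟩ := landauCoeff_restInv_landauCoeff_decay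
  refine ⟨81 * C, by positivity, ?_⟩
  intro H hH p q e₁ e₁' he₁ he₁'
  haveI : NeZero H := ⟨by omega⟩
  have hd : sumDist H ((skinRest H).symm e₁) ((skinRest H).symm e₁') = linkDist e₁ e₁' := by simp [sumDist]
  rw [hd, show ((4 : ℝ)) = ((4 : ℕ) : ℝ) by norm_num, Real.rpow_natCast]
  obtain ⟨κ, hκ⟩ := exists_linkDist_eq e₁ e₁'
  have h := hC H p q κ
  have hp := abs_sub_le_one_of_landauCoeff_ne_zero he₁ κ
  have hq := abs_sub_le_one_of_landauCoeff_ne_zero he₁' κ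
  have hshift : |((e₁.1.1.1 κ : ℤ) : ℝ) - ((e₁'.1.1.1 κ : ℤ) : ℝ)| ≤ |((p.1 κ : ℤ) : ℝ) - ((q.1 κ : ℤ) : ℝ)| + 2 := by
    have h1 := abs_sub_le (((e₁.1.1.1 κ : ℤ) : ℝ)) (((p.1 κ : ℤ) : ℝ)) (((e₁'.1.1.1 κ : ℤ) : ℝ))
    have h2 := abs_sub_le (((p.1 κ : ℤ) : ℝ)) (((q.1 κ : ℤ) : ℝ)) (((e₁'.1.1.1 κ : ℤ) : ℝ))
    rw [abs_sub_comm (((q.1 κ : ℤ) : ℝ))] at h2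
    linarith
  have hw := weight4_shift_le hshift
  rw [hκ, Int.cast_sub]
  have hX := abs_nonneg ((fun r : Rest H => landauCoeff H p r.1) ⬝ᵥ (restInv H *ᵥ fun r : Rest H => landauCoeff H q r.1))
  rw [Int.cast_sub] at h
  calc |(fun r : Rest H => landauCoeff H p r.1) ⬝ᵥ (restInv H *ᵥ fun r : Rest H => landauCoeff H q r.1)| *
          (1 + |((e₁.1.1.1 κ : ℤ) : ℝ) - ((e₁'.1.1.1 κ : ℤ) : ℝ)|) ^ 4
        ≤ |(fun r : Rest H => landauCoeff H p r.1) ⬝ᵥ (restInv H *ᵥ fun r : Rest H => landauCoeff H q r.1)| *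
          (81 * (1 + |((p.1 κ : ℤ) : ℝ) - ((q.1 κ : ℤ) : ℝ)|) ^ 4) := mul_le_mul_of_nonneg_left hw hX
    _ = 81 * (|(fun r : Rest H => landauCoeff H p r.1) ⬝ᵥ (restInv H *ᵥ fun r : Rest H => landauCoeff H q r.1)| *
          (1 + |((p.1 κ : ℤ) : ℝ) - ((q.1 κ : ℤ) : ℝ)|) ^ 4) := by ring
    _ ≤ 81 * C := mul_le_mul_of_nonneg_left h (by norm_num)

/-- One term of the skin trace: for a plaquette `q` through the skin link `s`, `|(λ_q|rest ⬝ᵥ u)·λ_q(s)|·(1 + d(s,e₁))⁴ ≤ 162·C` when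
`|λ_q|rest ⬝ᵥ u|·(1 + |q_κ − p_κ|)⁴ ≤ C` for every `κ` and the anchor `e₁` carries `λ_p`. -/
theorem term_a2_bound {p q : Plaq 4} {e₁ : LandauFree H} (he₁ : landauCoeff H p e₁ ≠ 0) (s : Skin H) (u : Rest H → ℝ) {C : ℝ}
    (hC : ∀ κ : Fin 4, |(fun r : Rest H => landauCoeff H q r.1) ⬝ᵥ u| * (1 + |((q.1 κ - p.1 κ : ℤ) : ℝ)|) ^ 4 ≤ C)
    (hq : landauCoeff H q s.1 ≠ 0) :
    |((fun r : Rest H => landauCoeff H q r.1) ⬝ᵥ u) * landauCoeff H q s.1| * (1 + linkDist s.1 e₁) ^ 4 ≤ 162 * C := by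
  obtain ⟨κ, hκ⟩ := exists_linkDist_eq s.1 e₁
  have h := hC κ
  have h1 := abs_sub_le_one_of_landauCoeff_ne_zero hq κ
  have h2 := abs_sub_le_one_of_landauCoeff_ne_zero he₁ κ
  have hshift : |((s.1.1.1.1 κ : ℤ) : ℝ) - ((e₁.1.1.1 κ : ℤ) : ℝ)| ≤ |((q.1 κ : ℤ) : ℝ) - ((p.1 κ : ℤ) : ℝ)| + 2 := by
    rw [abs_sub_comm] at h2
    have t1 := abs_sub_le (((s.1.1.1.1 κ : ℤ) : ℝ)) (((q.1 κ : ℤ) : ℝ)) (((e₁.1.1.1 κ : ℤ) : ℝ))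
    have t2 := abs_sub_le (((q.1 κ : ℤ) : ℝ)) (((p.1 κ : ℤ) : ℝ)) (((e₁.1.1.1 κ : ℤ) : ℝ))
    linarith
  have hw := weight4_shift_le hshift
  rw [hκ, Int.cast_sub]
  rw [Int.cast_sub] at h
  have hX := abs_nonneg ((fun r : Rest H => landauCoeff H q r.1) ⬝ᵥ u)
  have hA0 := abs_nonneg (((s.1.1.1.1 κ : ℤ) : ℝ) - ((e₁.1.1.1 κ : ℤ) : ℝ))
  have hW0 : 0 ≤ (1 + |((s.1.1.1.1 κ : ℤ) : ℝ) - ((e₁.1.1.1 κ : ℤ) : ℝ)|) ^ 4 := pow_nonneg (by linarith) 4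
  have hlam := abs_landauCoeff_le_two q s.1
  rw [abs_mul]
  calc |(fun r : Rest H => landauCoeff H q r.1) ⬝ᵥ u| * |landauCoeff H q s.1| * (1 + |((s.1.1.1.1 κ : ℤ) : ℝ) - ((e₁.1.1.1 κ : ℤ) : ℝ)|) ^ 4
        ≤ |(fun r : Rest H => landauCoeff H q r.1) ⬝ᵥ u| * 2 * (81 * (1 + |((q.1 κ : ℤ) : ℝ) - ((p.1 κ : ℤ) : ℝ)|) ^ 4) :=
        mul_le_mul (mul_le_mul_of_nonneg_left hlam hX) hw hW0 (mul_nonneg hX (by norm_num))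
    _ = 162 * (|(fun r : Rest H => landauCoeff H q r.1) ⬝ᵥ u| * (1 + |((q.1 κ : ℤ) : ℝ) - ((p.1 κ : ℤ) : ℝ)|) ^ 4) := by ring
    _ ≤ 162 * C := mul_le_mul_of_nonneg_left h (by norm_num)

/-- **`a₂`**: the skin trace of the rest response decays like `(1 + d(s, e₁))⁻⁴`: `(coupling *ᵥ restInv *ᵥ λ_p|rest)(s)` is the sum over the
`≤ 16` plaquettes `q` through `s` of `λ_q(s)·(λ_q|rest ⬝ᵥ restInv *ᵥ λ_p|rest)` (✓`coupling_mulVec_eq_sum`), each a re-anchored `a₃`. -/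
theorem source_a2 : ∃ a₂ : ℝ, 0 ≤ a₂ ∧ ∀ (H : ℕ), 1 ≤ H → ∀ {p : Plaq 4} {e₁ : LandauFree H}, landauCoeff H p e₁ ≠ 0 →
    ∀ s : Skin H, |(coupling H *ᵥ (restInv H *ᵥ fun r' : Rest H => landauCoeff H p r'.1)) s| *
      (1 + sumDist H (Sum.inl s) ((skinRest H).symm e₁)) ^ (4 : ℝ) ≤ a₂ := by
  classical
  obtain ⟨C, hC0, hC⟩ := landauCoeff_restInv_landauCoeff_decay
  refine ⟨16 * (162 * C), by positivity, ?_⟩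
  intro H hH p e₁ he₁ s
  haveI : NeZero H := ⟨by omega⟩
  have hd : sumDist H (Sum.inl s) ((skinRest H).symm e₁) = linkDist s.1 e₁ := by simp [sumDist]
  rw [hd, show ((4 : ℝ)) = ((4 : ℕ) : ℝ) by norm_num, Real.rpow_natCast, coupling_mulVec_eq_sum]
  have hW0 : 0 ≤ (1 + linkDist s.1 e₁) ^ 4 := pow_nonneg (by linarith [linkDist_nonneg s.1 e₁]) 4
  set t : Plaq 4 → ℝ := fun q =>
    ((fun r : Rest H => landauCoeff H q r.1) ⬝ᵥ (restInv H *ᵥ fun r' : Rest H => landauCoeff H p r'.1)) * landauCoeff H q s.1 with ht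
  have hterm : ∀ q ∈ (hodgePlaqs H).filter (fun q => landauCoeff H q s.1 ≠ 0), |t q| * (1 + linkDist s.1 e₁) ^ 4 ≤ 162 * C := by
    intro q hq
    exact term_a2_bound he₁ s _ (fun κ => hC H q p κ) (Finset.mem_filter.1 hq).2
  have hzero : ∀ q ∈ (hodgePlaqs H).filter (fun q => ¬ landauCoeff H q s.1 ≠ 0), |t q| * (1 + linkDist s.1 e₁) ^ 4 = 0 := by
    intro q hq
    have h0 : landauCoeff H q s.1 = 0 := not_not.1 (Finset.mem_filter.1 hq).2
    simp only [ht, h0, mul_zero, abs_zero, zero_mul]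
  have hcard := card_filter_landauCoeff_ne_zero_le (hodgePlaqs H) s.1
  calc |∑ q ∈ hodgePlaqs H, t q| * (1 + linkDist s.1 e₁) ^ 4
        ≤ (∑ q ∈ hodgePlaqs H, |t q|) * (1 + linkDist s.1 e₁) ^ 4 := mul_le_mul_of_nonneg_right (Finset.abs_sum_le_sum_abs _ _) hW0
    _ = ∑ q ∈ hodgePlaqs H, |t q| * (1 + linkDist s.1 e₁) ^ 4 := Finset.sum_mul _ _ _
    _ = (∑ q ∈ (hodgePlaqs H).filter (fun q => landauCoeff H q s.1 ≠ 0), |t q| * (1 + linkDist s.1 e₁) ^ 4) +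
          ∑ q ∈ (hodgePlaqs H).filter (fun q => ¬ landauCoeff H q s.1 ≠ 0), |t q| * (1 + linkDist s.1 e₁) ^ 4 :=
        (Finset.sum_filter_add_sum_filter_not _ _ _).symm
    _ = ∑ q ∈ (hodgePlaqs H).filter (fun q => landauCoeff H q s.1 ≠ 0), |t q| * (1 + linkDist s.1 e₁) ^ 4 := by
        rw [Finset.sum_eq_zero hzero, add_zero]
    _ ≤ ∑ q ∈ (hodgePlaqs H).filter (fun q => landauCoeff H q s.1 ≠ 0), (162 * C : ℝ) := Finset.sum_le_sum hterm
    _ = ((hodgePlaqs H).filter (fun q => landauCoeff H q s.1 ≠ 0)).card * (162 * C) := by rw [Finset.sum_const, nsmul_eq_mul]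
    _ ≤ 16 * (162 * C) := by
        apply mul_le_mul_of_nonneg_right _ (by positivity)
        exact_mod_cast hcard

end PlaqSource

end Summit.QuantumFields.YangMills.Theorems.AllWindowsColdBoxBoxHighLine

end
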